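import Mathlib
import HarnessLib
import HarnessLib.Audit
import Summits.ValiantsHypothesis.ValiantsHypothesis.Theorems.SymmetryDialAffinePebble

/-!
# SymmetryDial — disaligned compact CFI: a typed witness family for `AffinePebblePairs` (item 23711)

Route `SymmetryDial` (workshop `decomp-valiant`, lens 1, gen 9).  The leaf P′ = `AffinePebblePairs`
(∀ k′ ∃ d and `0/1` matrices `A, B` on `𝔽₂^d` with `C^{k′}`-equivalent AFFINE matrix structures and
different `0/1`-permanents) has been IDEA-NEEDED since gen 5: every Cai–Fürer–Immerman-type family the
lineage built (channelled Cayley twists g4, sparse CFI g3, fibred-translation twists and affine-slot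
gadgets g6) is read by ONE pebbled dual vector plus counting, because all of them are ALIGNED — the
edge functional of an edge is the same linear form at both of its ends, so a single hyperplane pebble
orients the edge at both ends (NODE-g6 lemmas (δ), (η)).  This file types the first DISALIGNED family.

* `Design d₀ r δ`: a Cayley graph on the base `𝔽₂^{d₀}` (label `i` joins `v` and `v + gen i`) and, for
  every base vertex `v` and label `i`, an edge functional `λ_{v,i} ∈ (𝔽₂^r)^*` (a FRAME of the fibre
  `𝔽₂^r ≅` even subsets of the star of `v`).  `Design.Good`: `δ = r+1` distinct nonzero generators, the
  `λ_{v,·}` form a frame (sum zero, trivial common kernel), and DISALIGNMENT `λ_{v,i} ≠ λ_{v+gᵢ,i}`.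
* `cfiMat D S t`: the compact CFI matrix on `𝔽₂^{d₀+r} = 𝔽₂^{d₀} × 𝔽₂^r` (no padding):
  `M((v,a),(w,b)) = 1` iff `w = v + gen i` and `λ_{v,i}(a) + λ_{w,i}(b) = t(v,w)`, or `v = w` and the
  within-fibre decoration `S v (a+b)` holds (a gauge-invariant knob: `⊥`, loops, full fibre blocks, …).
* `DisalignedPebble` (`@[conjecture]`, pebble side): for every `k′` some good design has
  `𝔄(cfiMat D S 0) ≡_{C^{k′}} 𝔄(cfiMat D S (one edge twisted))` for every decoration and every edge.
  Mechanism (NODE-g9 §3–§5): Duplicator plays fibrewise translations `σ : 𝔽₂^{d₀} → 𝔽₂^r` and answers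
  dual pebbles by shears `ξ ↦ ξ ∘ Φ_L`; a pebbled dual `β` only forces `v ↦ β(σ_v)` to be AFFINE and
  restricts the twist-moving steps at `v` to `ker β` — for disaligned frames no dual freezes an edge at
  both ends, and the obstructions are ALIGNED PATTERNS (edge 2-colourings locally induced by the pebbled
  span), absent for generic frames with `r ≥ 2k′(d₀ + log δ)`.
* `CompactCFIPerGap` (`@[conjecture]`, permanent side): for every good design and edge SOME decoration
  separates the `0/1`-permanents of the untwisted and the once-twisted matrix.  By `per01_reindex` the
  permanent does not see the frames at all (reframing = simultaneous row/column permutation), so this is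
  a statement about abstract compact CFI graphs; exact toys (NODE-g9 §6): with loops the gap is nonzero on
  all seven bases computed (K₃, C₄, K₄, K₃₃, prism, Q₃; e.g. Q₃: 1287200740461377 vs 1286928666240833),
  without decoration it vanishes on K₃, K₄, prism and is nonzero on the bipartite C₄, K₃₃, Q₃, K₄₄
  (K₄₄: `2^26·odd` vs `2^25·odd`).
* PROVED: `per01_reindex` (simultaneous reindexing invariance of the `0/1`-permanent — the kernel of
  frame independence), `good_design_example` (good disaligned designs exist: `d₀ = r = 2`, base `K₄`), and
  the assembly `affinePebblePairs_of : DisalignedPebble → CompactCFIPerGap → AffinePebblePairs`.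

LADDER-Valiant rung 0: nothing here bears on VP ≠ VNP; it supplies a candidate witness family for the
instrument-level statement P′ of route item 23711.  References: Cai–Fürer–Immerman 1992; Fürer 2001
(compact CFI); Dawar–Wilsenach 2025 §7 (arXiv:2503.15523v2); Hella 1996.
-/

set_option linter.dupNamespace false

namespace Summit.ValiantsHypothesis.ValiantsHypothesis.Theorems.SymmetryDialDisalignedCFI

open Finset
open Literature.Computability.AlgebraicComplexity
open SymmetryDialAffinePebble (V pair AffinePebbleEquiv AffinePebblePairs eval_perPoly_eq_card)

/-! ## §1 The `0/1`-permanent and its invariance under simultaneous reindexing -/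

/-- The `0/1`-permanent of a Boolean matrix on `𝔽₂^d` (the quantity compared in `AffinePebblePairs`). -/
noncomputable def per01 {d : ℕ} (A : V d × V d → Bool) : ℂ :=
  MvPolynomial.eval (fun ij => if A ij = true then (1 : ℂ) else 0) (perPoly (V d) ℂ)

/-- Conjugating the permutations: `{σ | ∀ i, A(φ σ i, φ i)}` and `{τ | ∀ i, A(τ i, i)}` are equinumerous. -/
theorem card_perm_reindex {d : ℕ} (A : V d × V d → Bool) (φ : V d ≃ V d) :
    (univ.filter fun σ : Equiv.Perm (V d) => ∀ i, A (φ (σ i), φ i) = true).card =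
      (univ.filter fun τ : Equiv.Perm (V d) => ∀ i, A (τ i, i) = true).card := by
  refine Finset.card_bij' (fun σ _ => φ.symm.trans (σ.trans φ)) (fun τ _ => φ.trans (τ.trans φ.symm))
    ?_ ?_ ?_ ?_
  · intro σ hσ
    simp only [mem_filter, mem_univ, true_and] at hσ ⊢
    intro i
    have h := hσ (φ.symm i)
    simpa using h
  · intro τ hτ
    simp only [mem_filter, mem_univ, true_and] at hτ ⊢
    intro i
    simpa using hτ (φ i)
  · intro σ _
    ext i
    simp
  · intro τ _
    ext i
    simp

/-- **Simultaneous reindexing invariance**: permuting rows and columns by the same bijection `φ` of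
`𝔽₂^d` does not change the `0/1`-permanent.  (Reframing a design is such a reindexing, fibre by fibre,
so the permanent of `cfiMat` never sees the frames — NODE-g9 (F1).) -/
theorem per01_reindex {d : ℕ} (A : V d × V d → Bool) (φ : V d ≃ V d) :
    per01 (fun ij => A (φ ij.1, φ ij.2)) = per01 A := by
  unfold per01
  rw [eval_perPoly_eq_card, eval_perPoly_eq_card]
  exact_mod_cast card_perm_reindex A φ

/-! ## §2 Framed Cayley designs and the compact CFI matrix on `𝔽₂^{d₀} × 𝔽₂^r` -/

variable {d₀ r δ : ℕ}

/-- Base part (first `d₀` coordinates) of a point of `𝔽₂^{d₀+r}`. -/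
def base (x : V (d₀ + r)) : V d₀ := fun i => x (Fin.castAdd r i)

/-- Fibre part (last `r` coordinates) of a point of `𝔽₂^{d₀+r}`. -/
def fib (x : V (d₀ + r)) : V r := fun j => x (Fin.natAdd d₀ j)

/-- A FRAMED CAYLEY DESIGN: generators of the base Cayley graph on `𝔽₂^{d₀}` (label `i` joins `v` and
`v + gen i`, the same label from both ends) and, per base vertex and label, the edge functional
`λ_{v,i} ∈ (𝔽₂^r)^*` in coordinates (`λ_{v,i}(a) = pair (lam v i) a`). -/
structure Design (d₀ r δ : ℕ) where
  /-- generators of the base Cayley graph -/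
  gen : Fin δ → V d₀
  /-- edge functionals, per base vertex and edge label -/
  lam : V d₀ → Fin δ → V r

/-- GOOD designs (a conjunction `card ∧ inj ∧ ne ∧ sum ∧ ker ∧ disaligned`): `δ = r + 1` distinct nonzero generators; at every vertex the `δ` functionals are a frame
of `(𝔽₂^r)^*` (they sum to zero and have trivial common kernel, so any `r` of them form a basis — the
image of the coordinate functionals of the even subsets of the star); DISALIGNED: the two ends of every
edge carry different functionals. -/
def Design.Good (D : Design d₀ r δ) : Prop :=
  δ = r + 1 ∧ Function.Injective D.gen ∧ (∀ i, D.gen i ≠ 0) ∧ (∀ v, ∑ i, D.lam v i = 0) ∧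
    (∀ v (a : V r), (∀ i, pair (D.lam v i) a = 0) → a = 0) ∧
      ∀ v i, D.lam v i ≠ D.lam (v + D.gen i) i

/-- The single-edge twist: `1` on the (ordered pairs of the) edge `{v₀, w₀}`, `0` elsewhere. -/
def twist1 (v₀ w₀ : V d₀) : V d₀ → V d₀ → Fin 2 :=
  fun v w => if (v = v₀ ∧ w = w₀) ∨ (v = w₀ ∧ w = v₀) then 1 else 0

/-- **The compact CFI matrix** of a framed design with twist `t` and within-fibre decoration `S`
(`S v c` is the entry of two points of fibre `v` with difference `c`):
`M((v,a),(w,b)) = 1` iff (`v = w` and `S v (a+b)`) or (`w = v + gen i` and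
`λ_{v,i}(a) + λ_{w,i}(b) = t(v,w)` for some label `i`). -/
def cfiMat (D : Design d₀ r δ) (S : V d₀ → V r → Bool) (t : V d₀ → V d₀ → Fin 2) :
    V (d₀ + r) × V (d₀ + r) → Bool := fun xy =>
  (decide (base xy.1 = base xy.2) && S (base xy.1) (fib xy.1 + fib xy.2)) ||
    decide (∃ i : Fin δ, base xy.2 = base xy.1 + D.gen i ∧
      pair (D.lam (base xy.1) i) (fib xy.1) + pair (D.lam (base xy.2) i) (fib xy.2) =
        t (base xy.1) (base xy.2))

/-! ## §3 The two conjectures and the assembly into P′ -/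

/-- **(Peb) disaligned pebble conjecture** (pebble side of NODE-g9): for every number of pebble pairs
`k′` there is a good disaligned design whose untwisted and once-twisted compact CFI matrices have
`C^{k′}`-equivalent affine matrix structures, for every within-fibre decoration and every twisted edge.
Why it might fail: a Spoiler strategy outside the fibrewise-translation analysis (the game reduction of
NODE-g9 §4 bounds Duplicator to shears + translations); cheapest falsifier: the census toy T2
(`d₀ = 4`, Clebsch base, `r = 4`, `d = 8`) at `k′ = 3`. -/
@[conjecture]
def DisalignedPebble : Prop :=
  ∀ k' : ℕ, ∃ (d₀ r δ : ℕ) (D : Design d₀ r δ), D.Good ∧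
    ∀ (S : V d₀ → V r → Bool) (v₀ : V d₀) (i₀ : Fin δ),
      AffinePebbleEquiv k' (d₀ + r) (cfiMat D S fun _ _ => 0)
        (cfiMat D S (twist1 v₀ (v₀ + D.gen i₀)))

/-- **(Per) compact-CFI permanent gap conjecture** (permanent side of NODE-g9): for every good design and
every edge, SOME within-fibre decoration separates the `0/1`-permanents of the untwisted and the
once-twisted matrix.  Frame-free by `per01_reindex`; exact evidence: loops separate on all seven toy
bases computed, no decoration separates exactly on the bipartite ones (NODE-g9 §6).  Why it might fail:
an accidental coincidence of two large integers for every decoration on some Cayley base. -/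
@[conjecture]
def CompactCFIPerGap : Prop :=
  ∀ (d₀ r δ : ℕ) (D : Design d₀ r δ), D.Good → ∀ (v₀ : V d₀) (i₀ : Fin δ),
    ∃ S : V d₀ → V r → Bool,
      per01 (cfiMat D S fun _ _ => 0) ≠ per01 (cfiMat D S (twist1 v₀ (v₀ + D.gen i₀)))

/-- **Assembly**: the two conjectures supply the witness family for P′ = `AffinePebblePairs`. -/
theorem affinePebblePairs_of (hPeb : DisalignedPebble) (hPer : CompactCFIPerGap) :
    AffinePebblePairs := by
  intro k'
  obtain ⟨d₀, r, δ, D, hD, hEq⟩ := hPeb k'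
  have hδ : 0 < δ := by rw [hD.1]; exact Nat.succ_pos r
  obtain ⟨S, hS⟩ := hPer d₀ r δ D hD 0 ⟨0, hδ⟩
  exact ⟨d₀ + r, _, _, hEq S 0 ⟨0, hδ⟩, hS⟩

/-! ## §4 Good disaligned designs exist (the smallest: base `K₄ = Cay(𝔽₂², {e₁, e₂, e₁+e₂})`, `r = 2`) -/

/-- Coordinates-to-vector helper on `𝔽₂²`. -/
def v2 (a b : Fin 2) : V 2 := ![a, b]

/-- The three nonzero functionals of `(𝔽₂²)^*`, indexed by `Fin 3`. -/
def fn3 : Fin 3 → V 2 := ![v2 1 0, v2 0 1, v2 1 1]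

/-- Per-vertex relabelling of the three functionals (found by exhaustive search; no "rotation"
`i ↦ i + c(v)` works, since that would properly `3`-colour `K₄`). -/
def permTab (v : V 2) : Fin 3 → Fin 3 :=
  if v = v2 0 0 then ![0, 1, 2] else if v = v2 1 0 then ![1, 0, 2]
    else if v = v2 0 1 then ![0, 2, 1] else ![1, 2, 0]

/-- The `K₄` design: generators `e₁, e₂, e₁+e₂` of `𝔽₂²`; at vertex `v` the label-`i` functional is
`fn3 (permTab v i)`; every one of the six edges is disaligned. -/
def designK4 : Design 2 2 3 where
  gen := ![v2 1 0, v2 0 1, v2 1 1]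
  lam := fun v i => fn3 (permTab v i)

/-- `designK4` is good (all six fields by computation). -/
theorem good_designK4 : designK4.Good := by
  refine ⟨rfl, ?_, by decide, by decide, by decide, by decide⟩
  intro i j h
  revert i j
  decide

/-- Good disaligned designs exist. -/
theorem good_design_example : ∃ D : Design 2 2 3, D.Good := ⟨designK4, good_designK4⟩

end Summit.ValiantsHypothesis.ValiantsHypothesis.Theorems.SymmetryDialDisalignedCFI
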